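import Summits.MatrixMultiplication.MatrixMultiplication.Theorems.FarEdgeDescentSignTwistDetAlgebra
import Summits.MatrixMultiplication.MatrixMultiplication.Theorems.FarEdgeDescentSignTwist
import Mathlib.LinearAlgebra.Matrix.Kronecker
import HarnessLib

/-!
# The determinant class of a twist: `𝔖^♭` and `𝔖^{♭ᵀ}` do not degenerate to `⟨2,2,2⟩`

Route `FarEdgeDescent` (cell `decomp-mm`, lens 2 «structural dichotomy (special vs generic)»,
gen 32), Kernel VII-det part 2; support for the aside `SubLogRate` (stmt-MatrixMultiplication-25371).

A NEW degeneration obstruction (neither a support functional nor a pairing/rigidity argument):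
the DETERMINANT CLASS of the generic `X`-slice.  For a tensor `s` whose first and third slots have
the same index type, contract the middle slot against generic variables `x` and take the
determinant of the resulting square matrix `S(x)`; under `GL × GL × GL` this form changes only by a
scalar and a linear substitution, and under a degeneration `ε^h t + O(ε^{h+1}) = (A(ε)⊗B(ε)⊗C(ε))·s`
one gets the exact identity (`slice_identity`)

  `ε^{h·n} · D(ε) = det A(ε) det C(ε) · det S(B(ε)ᵀx)`,  `D(0) = det T(x)`  in `K[x][ε]`.

For `s = 𝔖^♭` (sign star) `det S(y) = det Y · perm Y = (y₀₀y₁₁ - y₀₁y₁₀)(y₀₀y₁₁ + y₀₁y₁₀)`,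
for `t = ⟨2,2,2⟩` `det T(x) = (det X)²`; trailing coefficients in `ε` and the algebra of
`FarEdgeDescentSignTwistDetAlgebra.lean` (`det X` prime; a product of two linear forms is not
`κ·det X`) give the contradiction.  Main results (characteristic `≠ 2`):

* `signStar_not_algDegeneratesTo_matMul : ¬ 𝔖^♭ ⊵ ⟨2,2,2⟩`,
* `signTStar_not_algDegeneratesTo_matMul : ¬ 𝔖^{♭ᵀ} ⊵ ⟨2,2,2⟩`
  (same slice determinant `det Y · perm Y`),

complementing `⟨2,2,2⟩^{⊠N} ⋭ (𝔖^♭)^{⊠N}` (`FarEdgeDescentSignTwist.lean`): at `N = 1` the sign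
classes and `⟨2,2,2⟩` are DEGENERATION-incomparable, although all quantum functionals agree on
them (`FarEdgeDescentTwistQuantumTwin.lean`).

References: P. Bürgisser, M. Clausen, M. A. Shokrollahi, *Algebraic Complexity Theory* (1997),
(15.19), §20.2 [BurgisserClausenShokrollahi1997]; V. Strassen, J. reine angew. Math. 375/376
(1987), §4 [Strassen1987].
-/

noncomputable section

open scoped BigOperators Polynomial Matrix

set_option linter.dupNamespace false

namespace Summit.MatrixMultiplication.MatrixMultiplication.Theorems.FarEdgeDescentSignTwistDet

open Literature.Computability.AlgebraicComplexity
open Summit.MatrixMultiplication.MatrixMultiplication.Theorems.FarEdgeDescentSignTwist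

universe u

/-! ## The slice identity of a degeneration -/

section Base
variable {K : Type u} [Field K] {κ' : Type*}

/-- Base change `K[ε] → K[x][ε]`. [folklore] -/
def φK (κ' : Type*) : K[X] →+* (MvPolynomial κ' K)[X] := Polynomial.mapRingHom MvPolynomial.C

/-- `φ (C k) = C (C k)`. [folklore] -/
@[simp] theorem φK_C (k : K) : φK κ' (Polynomial.C k) = Polynomial.C (MvPolynomial.C k) := by
  simp [φK]

/-- `φ X = X`. [folklore] -/
@[simp] theorem φK_X : φK (K := K) κ' Polynomial.X = Polynomial.X := by
  simp [φK]

/-- Coefficients of `φ p` are constants. [folklore] -/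
theorem coeff_φK (p : K[X]) (k : ℕ) : (φK κ' p).coeff k = MvPolynomial.C (p.coeff k) := by
  simp [φK, Polynomial.coeff_map]

end Base

section Slice
variable {K : Type u} [Field K]
variable {ι κ ι' κ' : Type*} [Fintype ι] [Fintype κ] [Fintype κ']

/-- The entries `(A ⊗ B ⊗ C)·s` of a degeneration, as polynomials in `ε`. [folklore] -/
def entry (s : ι → κ → ι → K) (A : ι' → ι → K[X]) (B : κ' → κ → K[X]) (C : ι' → ι → K[X])
    (a' : ι') (b' : κ') (c' : ι') : K[X] :=
  ∑ a, ∑ b, ∑ c, A a' a * B b' b * C c' c * Polynomial.C (s a b c)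

/-- The substituted middle variables `y_b = ∑_{b'} x_{b'} B_{b'b}(ε) ∈ K[x][ε]`. [folklore] -/
def yv (B : κ' → κ → K[X]) (b : κ) : (MvPolynomial κ' K)[X] :=
  ∑ b', Polynomial.C (MvPolynomial.X b') * φK κ' (B b' b)

/-- The `y`-slice `S(y)_{ac} = ∑_b y_b s_{abc}` of `s`. [folklore] -/
def Smat (s : ι → κ → ι → K) (y : κ → (MvPolynomial κ' K)[X]) :
    Matrix ι ι (MvPolynomial κ' K)[X] :=
  Matrix.of fun a c => ∑ b, y b * Polynomial.C (MvPolynomial.C (s a b c))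

/-- The generic `x`-slice `T(x)_{a'c'} = ∑_{b'} x_{b'} t_{a'b'c'}` of `t`. [folklore] -/
def Tmat (t : ι' → κ' → ι' → K) : Matrix ι' ι' (MvPolynomial κ' K) :=
  Matrix.of fun a' c' => ∑ b', MvPolynomial.X b' * MvPolynomial.C (t a' b' c')

/-- The `x`-slice of `(A ⊗ B ⊗ C)·s`. [folklore] -/
def Lmat (s : ι → κ → ι → K) (A : ι' → ι → K[X]) (B : κ' → κ → K[X]) (C : ι' → ι → K[X]) :
    Matrix ι' ι' (MvPolynomial κ' K)[X] :=
  Matrix.of fun a' c' => ∑ b', Polynomial.C (MvPolynomial.X b') * φK κ' (entry s A B C a' b' c')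

/-- **Factorisation of the slice**: `L = A^φ · S(y) · (C^φ)ᵀ`. [folklore] -/
theorem Lmat_eq_mul (s : ι → κ → ι → K) (A : ι' → ι → K[X]) (B : κ' → κ → K[X])
    (C : ι' → ι → K[X]) :
    Lmat s A B C = (Matrix.of fun a' a => φK κ' (A a' a)) * Smat s (yv B) *
      (Matrix.of fun c' c => φK κ' (C c' c))ᵀ := by
  ext a' c' : 1
  have lhs : Lmat s A B C a' c' = ∑ a, ∑ b, ∑ c, ∑ b',
      Polynomial.C (MvPolynomial.X b') * (φK κ' (A a' a) * φK κ' (B b' b) * φK κ' (C c' c) *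
        Polynomial.C (MvPolynomial.C (s a b c))) := by
    simp only [Lmat, entry, Matrix.of_apply, map_sum, map_mul, φK_C, Finset.mul_sum]
    rw [Finset.sum_comm]
    refine Finset.sum_congr rfl fun a _ => ?_
    rw [Finset.sum_comm]
    refine Finset.sum_congr rfl fun b _ => ?_
    rw [Finset.sum_comm]
  have rhs : ((Matrix.of fun a' a => φK κ' (A a' a)) * Smat s (yv B) *
      (Matrix.of fun c' c => φK κ' (C c' c))ᵀ) a' c' = ∑ a, ∑ b, ∑ c, ∑ b',
      Polynomial.C (MvPolynomial.X b') * (φK κ' (A a' a) * φK κ' (B b' b) * φK κ' (C c' c) *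
        Polynomial.C (MvPolynomial.C (s a b c))) := by
    simp only [Matrix.mul_apply, Matrix.transpose_apply, Matrix.of_apply, Smat, yv,
      Finset.sum_mul, Finset.mul_sum]
    rw [Finset.sum_comm]
    refine Finset.sum_congr rfl fun a _ => ?_
    rw [Finset.sum_comm]
    refine Finset.sum_congr rfl fun b _ => ?_
    refine Finset.sum_congr rfl fun c _ => ?_
    refine Finset.sum_congr rfl fun b' _ => ?_
    ring
  rw [lhs, rhs]

omit [Fintype ι] [Fintype κ] in
/-- Every `ε`-coefficient of `y_b` is a linear form in `x`. [folklore] -/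
theorem coeff_yv_isHomogeneous (B : κ' → κ → K[X]) (b : κ) (k : ℕ) :
    ((yv B b).coeff k).IsHomogeneous 1 := by
  rw [yv, Polynomial.finsetSum_coeff]
  refine MvPolynomial.IsHomogeneous.sum _ _ _ fun b' _ => ?_
  rw [Polynomial.coeff_C_mul, coeff_φK]
  simpa using (MvPolynomial.isHomogeneous_X K b').mul
    (MvPolynomial.isHomogeneous_C κ' ((B b' b).coeff k))

omit [Fintype κ'] in
/-- Unfolding of `IsApproxRestriction` at a coefficient. [cite: BurgisserClausenShokrollahi1997, (15.19)] -/
theorem hd_coeff {h : ℕ} {s : ι → κ → ι → K} {t : ι' → κ' → ι' → K}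
    {A : ι' → ι → K[X]} {B : κ' → κ → K[X]} {C : ι' → ι → K[X]}
    (hd : IsApproxRestriction h s t A B C) (a' : ι') (b' : κ') (c' : ι') (j : ℕ) (hj : j ≤ h) :
    (∑ a, ∑ b, ∑ c, A a' a * B b' b * C c' c * Polynomial.C (s a b c)).coeff j =
      if j = h then t a' b' c' else 0 :=
  hd a' b' c' j hj

/-- **Order-`h` structure of the slice**: `L = ε^h (T(x) + ε G)` for a degeneration of order `h`.
[cite: BurgisserClausenShokrollahi1997, (15.19)] -/
theorem Lmat_eq_smul {h : ℕ} {s : ι → κ → ι → K} {t : ι' → κ' → ι' → K} {A : ι' → ι → K[X]}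
    {B : κ' → κ → K[X]} {C : ι' → ι → K[X]} (hd : IsApproxRestriction h s t A B C) :
    ∃ G : Matrix ι' ι' (MvPolynomial κ' K)[X],
      Lmat s A B C = ((Polynomial.X : (MvPolynomial κ' K)[X]) ^ h) •
        ((Tmat t).map Polynomial.C + (Polynomial.X : (MvPolynomial κ' K)[X]) • G) := by
  have hdiv : ∀ a' b' c', ∃ g : K[X], entry s A B C a' b' c' =
      Polynomial.X ^ h * (Polynomial.C (t a' b' c') + Polynomial.X * g) := by
    intro a' b' c'
    have hx : Polynomial.X ^ (h + 1) ∣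
        entry s A B C a' b' c' - Polynomial.C (t a' b' c') * Polynomial.X ^ h := by
      rw [Polynomial.X_pow_dvd_iff]
      intro d hdlt
      rw [Polynomial.coeff_sub, Polynomial.coeff_C_mul_X_pow]
      unfold entry
      rw [hd_coeff hd a' b' c' d (Nat.lt_succ_iff.mp hdlt), sub_self]
    obtain ⟨g, hg⟩ := hx
    exact ⟨g, by linear_combination hg⟩
  choose g hg using hdiv
  refine ⟨Matrix.of fun a' c' => ∑ b', Polynomial.C (MvPolynomial.X b') * φK κ' (g a' b' c'), ?_⟩
  ext a' c' : 1
  simp only [Lmat, Tmat, Matrix.of_apply, Matrix.smul_apply, Matrix.add_apply, Matrix.map_apply,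
    smul_eq_mul, hg, map_mul, map_pow, map_add, map_sum, φK_C, φK_X, mul_add, Finset.mul_sum,
    ← Finset.sum_add_distrib]
  refine Finset.sum_congr rfl fun b' _ => ?_
  ring

omit [Fintype ι] [Fintype κ] in
/-- Coefficients of a product `y_b y_{b'}` are quadratic forms. [folklore] -/
theorem coeff_yv_mul_isHomogeneous (B : κ' → κ → K[X]) (b b' : κ) (k : ℕ) :
    ((yv B b * yv B b').coeff k).IsHomogeneous 2 := by
  rw [Polynomial.coeff_mul]
  exact MvPolynomial.IsHomogeneous.sum _ _ _ fun x _ =>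
    (coeff_yv_isHomogeneous B b x.1).mul (coeff_yv_isHomogeneous B b' x.2)

variable [Fintype ι'] [DecidableEq ι']

/-- **The determinant of the slice has order `≥ h·n` with leading term `det T(x)`.** [folklore] -/
theorem det_Lmat_eq {h : ℕ} {s : ι → κ → ι → K} {t : ι' → κ' → ι' → K} {A : ι' → ι → K[X]}
    {B : κ' → κ → K[X]} {C : ι' → ι → K[X]} (hd : IsApproxRestriction h s t A B C) :
    ∃ D : (MvPolynomial κ' K)[X],
      (Lmat s A B C).det = Polynomial.X ^ (h * Fintype.card ι') * D ∧ D.coeff 0 = (Tmat t).det := by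
  obtain ⟨G, hG⟩ := Lmat_eq_smul hd
  refine ⟨((Tmat t).map Polynomial.C + (Polynomial.X : (MvPolynomial κ' K)[X]) • G).det, ?_, ?_⟩
  · rw [hG, Matrix.det_smul, ← pow_mul]
  · rw [Polynomial.coeff_zero_eq_eval_zero, ← Polynomial.coe_evalRingHom, RingHom.map_det]
    congr 1
    ext a' c' : 1
    simp [Matrix.map_apply]

variable [DecidableEq ι]

/-- **The slice determinant factors through `det S(y)`**: `det L = φ(det A' · det C') · det S(y)`
(`A'`, `C'` the matrices reindexed along `e : ι' ≃ ι`). [folklore] -/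
theorem det_Lmat_eq_mul (e : ι' ≃ ι) (s : ι → κ → ι → K) (A : ι' → ι → K[X]) (B : κ' → κ → K[X])
    (C : ι' → ι → K[X]) :
    (Lmat s A B C).det = φK κ' ((Matrix.of fun a' j => A a' (e j)).det *
      (Matrix.of fun c' j => C c' (e j)).det) * (Smat s (yv B)).det := by
  have h1 : Lmat s A B C = ((Matrix.of fun a' a => φK κ' (A a' a)).submatrix id e) *
      (Smat s (yv B)).submatrix e e * ((Matrix.of fun c' c => φK κ' (C c' c)).submatrix id e)ᵀ := by
    rw [Lmat_eq_mul, Matrix.transpose_submatrix, Matrix.submatrix_mul_equiv,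
      Matrix.submatrix_mul_equiv, Matrix.submatrix_id_id]
  have hA : (Matrix.of fun a' a => φK κ' (A a' a)).submatrix id e =
      (φK κ').mapMatrix (Matrix.of fun a' j => A a' (e j)) := by
    ext; simp
  have hC : (Matrix.of fun c' c => φK κ' (C c' c)).submatrix id e =
      (φK κ').mapMatrix (Matrix.of fun c' j => C c' (e j)) := by
    ext; simp
  rw [h1, Matrix.det_mul, Matrix.det_mul, Matrix.det_transpose, Matrix.det_submatrix_equiv_self,
    hA, hC, ← RingHom.map_det, ← RingHom.map_det, map_mul]
  ring

/-- **The slice identity of a degeneration** `t ⊴_h s` (first and third slots of equal format,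
`e : ι' ≃ ι`): `ε^{h·|ι'|} · D = φ(q) · det S(y)` in `K[x][ε]` with `D(0) = det T(x)`.
[cite: BurgisserClausenShokrollahi1997, (15.19)] -/
theorem slice_identity {h : ℕ} {s : ι → κ → ι → K} {t : ι' → κ' → ι' → K} {A : ι' → ι → K[X]}
    {B : κ' → κ → K[X]} {C : ι' → ι → K[X]} (hd : IsApproxRestriction h s t A B C) (e : ι' ≃ ι) :
    ∃ (q : K[X]) (D : (MvPolynomial κ' K)[X]),
      Polynomial.X ^ (h * Fintype.card ι') * D = φK κ' q * (Smat s (yv B)).det ∧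
        D.coeff 0 = (Tmat t).det := by
  obtain ⟨D, hD, hD0⟩ := det_Lmat_eq hd
  exact ⟨_, D, by rw [← hD, det_Lmat_eq_mul e], hD0⟩

end Slice

/-! ## The sign classes versus `⟨2,2,2⟩` -/

section SignStar
variable (K : Type u) [Field K]

/-- A `2 × 2` matrix over the leaf index `Fin 2 × Fin 1`. [folklore] -/
def leafMat {S : Type*} (f : Fin 2 → Fin 2 → S) : Matrix (Fin 2 × Fin 1) (Fin 2 × Fin 1) S :=
  Matrix.of fun a c => f a.1 c.1

/-- `det` of a leaf matrix. [folklore] -/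
theorem det_leafMat {S : Type*} [CommRing S] (f : Fin 2 → Fin 2 → S) :
    (leafMat f).det = f 0 0 * f 1 1 - f 0 1 * f 1 0 := by
  rw [← Matrix.det_submatrix_equiv_self (Equiv.prodUnique (Fin 2) (Fin 1)).symm, Matrix.det_fin_two]
  simp [leafMat, Equiv.prodUnique_symm_apply]

/-- **The `y`-slice of the sign star is `Y ⊕ Y^♭`.** [cite: CohnUmans2013, §3] -/
theorem Smat_signStar (y : Fin 2 × Fin 2 → (Rx K)[X]) :
    Smat (signStar K) y = Matrix.fromBlocks (leafMat fun i j => y (i, j)) 0 0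
      (leafMat fun i j => y (i, j) * Polynomial.C (MvPolynomial.C (sgnWeight K (i, j)))) := by
  ext x x'
  rcases x with ⟨i, l⟩ | ⟨i, l⟩ <;> rcases x' with ⟨j, l'⟩ | ⟨j, l'⟩ <;>
  · obtain rfl : l = 0 := Subsingleton.elim _ _
    obtain rfl : l' = 0 := Subsingleton.elim _ _
    fin_cases i <;> fin_cases j <;>
      simp [Smat, leafMat, Fintype.sum_prod_type, Fin.sum_univ_two, sgnWeight, matMulTensor]

/-- **The `y`-slice of the transposed sign star is `Y ⊕ (Y^♭)ᵀ`.** [cite: CohnUmans2013, §3] -/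
theorem Smat_signTStar (y : Fin 2 × Fin 2 → (Rx K)[X]) :
    Smat (signTStar K) y = Matrix.fromBlocks (leafMat fun i j => y (i, j)) 0 0
      (leafMat fun i j => y (j, i) * Polynomial.C (MvPolynomial.C (sgnWeight K (j, i)))) := by
  ext x x'
  rcases x with ⟨i, l⟩ | ⟨i, l⟩ <;> rcases x' with ⟨j, l'⟩ | ⟨j, l'⟩ <;>
  · obtain rfl : l = 0 := Subsingleton.elim _ _
    obtain rfl : l' = 0 := Subsingleton.elim _ _
    fin_cases i <;> fin_cases j <;>
      simp [Smat, leafMat, Fintype.sum_prod_type, Fin.sum_univ_two, sgnWeight, matMulTensor]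

/-- The sign weight at `(1,0)`. [cite: CohnUmans2013, §3] -/
@[simp] theorem sgnWeight_one_zero : sgnWeight K (1, 0) = -1 := if_pos rfl

/-- The sign weight off `(1,0)`. [cite: CohnUmans2013, §3] -/
theorem sgnWeight_of_ne {b : Fin 2 × Fin 2} (hb : b ≠ (1, 0)) : sgnWeight K b = 1 := if_neg hb

/-- **`det S(y) = det Y · perm Y`** for the sign star. [folklore] -/
theorem det_Smat_signStar (y : Fin 2 × Fin 2 → (Rx K)[X]) :
    (Smat (signStar K) y).det =
      (y (0, 0) * y (1, 1) - y (0, 1) * y (1, 0)) * (y (0, 0) * y (1, 1) + y (0, 1) * y (1, 0)) := by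
  rw [Smat_signStar, Matrix.det_fromBlocks_zero₂₁, det_leafMat, det_leafMat]
  simp only [sgnWeight_one_zero, sgnWeight_of_ne K (b := (0, 0)) (by decide),
    sgnWeight_of_ne K (b := (0, 1)) (by decide), sgnWeight_of_ne K (b := (1, 1)) (by decide),
    map_one, map_neg, mul_one]
  ring

/-- **`det S(y) = det Y · perm Y`** for the transposed sign star, too. [folklore] -/
theorem det_Smat_signTStar (y : Fin 2 × Fin 2 → (Rx K)[X]) :
    (Smat (signTStar K) y).det =
      (y (0, 0) * y (1, 1) - y (0, 1) * y (1, 0)) * (y (0, 0) * y (1, 1) + y (0, 1) * y (1, 0)) := by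
  rw [Smat_signTStar, Matrix.det_fromBlocks_zero₂₁, det_leafMat, det_leafMat]
  simp only [sgnWeight_one_zero, sgnWeight_of_ne K (b := (0, 0)) (by decide),
    sgnWeight_of_ne K (b := (0, 1)) (by decide), sgnWeight_of_ne K (b := (1, 1)) (by decide),
    map_one, map_neg, mul_one]
  ring

/-- **The generic `x`-slice of `⟨2,2,2⟩` is `X ⊗ 1₂`.** [folklore] -/
theorem Tmat_matMul : Tmat (matMulTensor K 2 2 (1 + 1)) =
    Matrix.kroneckerMap (· * ·) (Matrix.of fun i j : Fin 2 => (MvPolynomial.X (i, j) : Rx K))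
      (1 : Matrix (Fin (1 + 1)) (Fin (1 + 1)) (Rx K)) := by
  ext ⟨i, k⟩ ⟨j, k'⟩
  simp only [Tmat, Matrix.of_apply, Matrix.kroneckerMap_apply, matMulTensor, Fintype.sum_prod_type,
    Fin.sum_univ_two, Matrix.one_apply]
  fin_cases i <;> fin_cases j <;> fin_cases k <;> fin_cases k' <;> simp

/-- **`det T(x) = (det X)²`** for `⟨2,2,2⟩`. [folklore] -/
theorem det_Tmat_matMul : (Tmat (matMulTensor K 2 2 (1 + 1))).det = detX K ^ 2 := by
  rw [Tmat_matMul, Matrix.det_kronecker, Matrix.det_one, one_pow, mul_one, ← detX_eq_det]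
  simp

variable {K}

/-- The common core: no degeneration `s ⊵ ⟨2,2,2⟩` when `det S(y) = det Y · perm Y`.
[cite: BurgisserClausenShokrollahi1997, (15.19)] -/
theorem not_algDegeneratesTo_matMul_of_det_slice (h2 : (2 : K) ≠ 0)
    (s : (Fin 2 × Fin 1) ⊕ (Fin 2 × Fin 1) → (Fin 2 × Fin 2) → (Fin 2 × Fin 1) ⊕ (Fin 2 × Fin 1) → K)
    (hs : ∀ y : Fin 2 × Fin 2 → (Rx K)[X], (Smat s y).det =
      (y (0, 0) * y (1, 1) - y (0, 1) * y (1, 0)) * (y (0, 0) * y (1, 1) + y (0, 1) * y (1, 0))) :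
    ¬ AlgDegeneratesTo s (matMulTensor K 2 2 (1 + 1)) := by
  rintro ⟨h, A, B, C, hd⟩
  obtain ⟨q, D, hqD, hD0⟩ := slice_identity hd (Fintype.equivOfCardEq (by simp))
  rw [hs, det_Tmat_matMul] at *
  have hD : D.trailingCoeff = detX K ^ 2 := by
    have h0 : D.coeff 0 ≠ 0 := by rw [hD0]; exact pow_ne_zero _ (detX_ne_zero K)
    have hn : D.natTrailingDegree = 0 := Nat.le_zero.mp (Polynomial.natTrailingDegree_le_of_ne_zero h0)
    rw [Polynomial.trailingCoeff, hn, hD0]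
  have hX : ∀ n : ℕ, ((Polynomial.X : (Rx K)[X]) ^ n).trailingCoeff = 1 := fun n => by
    rw [Polynomial.trailingCoeff, Polynomial.natTrailingDegree_X_pow, Polynomial.coeff_X_pow,
      if_pos rfl]
  have hq : (φK (Fin 2 × Fin 2) q).trailingCoeff =
      MvPolynomial.C (q.coeff (φK (Fin 2 × Fin 2) q).natTrailingDegree) := coeff_φK q _
  have htc := congrArg Polynomial.trailingCoeff hqD
  rw [Polynomial.trailingCoeff_mul, Polynomial.trailingCoeff_mul, Polynomial.trailingCoeff_mul, hX,
    one_mul, hD, hq, ← mul_assoc] at htc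
  have hP : ((yv B (0, 0) * yv B (1, 1) - yv B (0, 1) * yv B (1, 0)).trailingCoeff).IsHomogeneous 2 := by
    rw [Polynomial.trailingCoeff, Polynomial.coeff_sub]
    exact (coeff_yv_mul_isHomogeneous B _ _ _).sub (coeff_yv_mul_isHomogeneous B _ _ _)
  have hQ : ((yv B (0, 0) * yv B (1, 1) + yv B (0, 1) * yv B (1, 0)).trailingCoeff).IsHomogeneous 2 := by
    rw [Polynomial.trailingCoeff, Polynomial.coeff_add]
    exact (coeff_yv_mul_isHomogeneous B _ _ _).add (coeff_yv_mul_isHomogeneous B _ _ _)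
  obtain ⟨⟨κ₁, hκ₁, h₁⟩, ⟨κ₂, hκ₂, h₂⟩⟩ := pair_eq_C_mul_detX hP hQ htc
  exact trailing_contradiction h2 (yv B) (coeff_yv_isHomogeneous B) hκ₁ hκ₂ h₁ h₂

variable (K)

/-- **The sign star does not degenerate to `⟨2,2,2⟩`**: `¬ 𝔖^♭ ⊵ ⟨2,2,2⟩` (characteristic
`≠ 2`) — the determinant class `det Y · perm Y` of its slice cannot degenerate to `(det X)²`.
[cite: BurgisserClausenShokrollahi1997, (15.19), §20.2] -/
theorem signStar_not_algDegeneratesTo_matMul (h2 : (2 : K) ≠ 0) :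
    ¬ AlgDegeneratesTo (signStar K) (matMulTensor K 2 2 (1 + 1)) :=
  not_algDegeneratesTo_matMul_of_det_slice h2 _ (det_Smat_signStar K)

/-- **The transposed sign star does not degenerate to `⟨2,2,2⟩`**: `¬ 𝔖^{♭ᵀ} ⊵ ⟨2,2,2⟩`
(characteristic `≠ 2`). [cite: BurgisserClausenShokrollahi1997, (15.19), §20.2] -/
theorem signTStar_not_algDegeneratesTo_matMul (h2 : (2 : K) ≠ 0) :
    ¬ AlgDegeneratesTo (signTStar K) (matMulTensor K 2 2 (1 + 1)) :=
  not_algDegeneratesTo_matMul_of_det_slice h2 _ (det_Smat_signTStar K)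

/-- **Degeneration-incomparability at `N = 1`** (characteristic `≠ 2`): neither of `⟨2,2,2⟩`,
`𝔖^♭` degenerates to the other, and likewise for `𝔖^{♭ᵀ}`.
[cite: BurgisserClausenShokrollahi1997, (15.19)] -/
theorem sign_classes_degeneration_incomparable (h2 : (2 : K) ≠ 0) :
    (¬ AlgDegeneratesTo (signStar K) (matMulTensor K 2 2 (1 + 1)) ∧
      ¬ AlgDegeneratesTo (matMulTensor K 2 2 (1 + 1)) (signStar K)) ∧
    (¬ AlgDegeneratesTo (signTStar K) (matMulTensor K 2 2 (1 + 1)) ∧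
      ¬ AlgDegeneratesTo (matMulTensor K 2 2 (1 + 1)) (signTStar K)) := by
  refine ⟨⟨signStar_not_algDegeneratesTo_matMul K h2, ?_⟩,
    ⟨signTStar_not_algDegeneratesTo_matMul K h2, ?_⟩⟩
  · exact fun hd => matMul_pow_not_algDegeneratesTo_signStar_pow K h2 1 le_rfl (hd.kroneckerPow 1)
  · exact fun hd => matMul_pow_not_algDegeneratesTo_signTStar_pow K h2 1 le_rfl (hd.kroneckerPow 1)

end SignStar

end Summit.MatrixMultiplication.MatrixMultiplication.Theorems.FarEdgeDescentSignTwistDet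

end
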